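import Summits.Ventures.PackingBounds.ThreePointCert.C9ECertB

/-!
# A(9, arccos 1/3) ≤ 98: kernel instance of the exact value-99 three-point certificate — the certificate records

Framing: lottery ticket; floor = certified bounds/negative ranges. Venture `PackingBounds` (cell
`pub-packcert`), three-point SDP family. Integer data of the EXACT (slack-free) Bachoc–Vallentin
certificate of value exactly `99` for `A(9, arccos 1/3)` (n = 9, s = 1/3, degree 10, symmetric sums of
squares, `B = 0`; every block on its optimal face), produced by `pub-packcert-lp` gen 4 (`code/k99/job4.py`,
strategy S4_a_R0rest_F) from the cell's exact certificate `sdp-n9-d10-s1-3-sym-exact99-r2.json` (pub-packcert-sdp gen 4;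
two independent exact verifiers + referee), in the units of the kernel checker `ThreePointCert.CheckExact`
(soundness `ThreePointCert.SoundExact`, `SoundExact2`). Generated file: plain lists of integers / monomials.
-/

namespace Summit.Ventures.PackingBounds.ThreePointCert.C9E

open Literature.Geometry.DiscreteGeometry Literature.Geometry.DiscreteGeometry.PolyCert PolyCert.SPoly

/-- The parts of the multiplier-0 sum of squares. -/
def parts0 : List SymPart := [pR0trv, pR0alt, pR0std]

/-- The parts of the multiplier-1 sum of squares. -/
def parts1 : List SymPart := [pR1trv, pR1alt, pR1std]

/-- The parts of the multiplier-2 sum of squares. -/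
def parts2 : List SymPart := [pR2trv, pR2alt, pR2std]

/-- The parts of the multiplier-3 sum of squares. -/
def parts3 : List SymPart := [pR3trv, pR3alt, pR3std]

/-- The parts of the multiplier-4 sum of squares. -/
def parts4 : List SymPart := [pR4trv, pR4alt, pR4std]

/-- The three-point blocks. -/
def fblocks : List FBlkX := [fb0, fb1, fb2, fb3, fb4, fb5, fb6, fb7, fb8, fb9]

/-- The exact certificate. -/
def cert : CertX :=
  ⟨9, 10, 1, 3, 229963695335216716901369449650279268378152981549944883146034850796497877211608415437523517440000, 99, eA, fblocks, parts0, parts1, parts2, parts3, parts4,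
   1, [1053351918824325120000, 29542730345264215312827457691185053696000000, 9847576781754738437609152563728351232000000, 3282525593918246145869717521242783744000000, 88628191035792645938482373073555161088000000], 1, ewP, ehP, 2658455991569831745807614120560689152, 1634266505300182082235812479244033460441442563646585142599799445765300547990412143387117043730201724626715207203147051791633880836963565568⟩

/-- The claimed expansions. -/
def polys : PolysX := ⟨eFP, [eTOT0, eTOT1, eTOT2, eTOT3, eTOT4], eEH0, eEH1⟩

/-- Gram block of the positivity certificate of `h` (multiplier 1). -/
def gh0 : GramBlk := ⟨(List.range 8).map fun i => ⟨i, 0, 0⟩, gh0L⟩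

/-- Gram block of the positivity certificate of `h` (multiplier `g_q`). -/
def gh1 : GramBlk := ⟨(List.range 7).map fun i => ⟨i, 0, 0⟩, gh1L⟩

end Summit.Ventures.PackingBounds.ThreePointCert.C9E
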